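import Summits.NavierStokesRegularity.FluidComputer.ModulatedCollapseLiouville
import Literature.Analysis.FluidPDE.TsaiLocalEnergyHolds
import HarnessLib

/-!
# The exact one-profile modulated collapse in the LOCAL ENERGY class is trivial, for ANY clock
# (Tsai 1998, Theorem 2, transported along `ModulatedCollapseLiouville`)

Summit `NavierStokesRegularity`, cell topic directory `FluidComputer`, namespace
`…FluidComputer.SelfSimilarCensus`; last link of the chain `ModulatedCollapseGaugeRigidity` →
`…Local` → `ModulatedCollapseLiouville`. There the non-trivial branch of an exact one-profile
modulated collapse `u(t, x) = λ(t) • U(λ(t) • x)`, `p = λ(t)² P(λ(t) • x)` (ANY differentiable clock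
`λ > 0` with `λ → +∞` at `T`; momentum equation on a parabolic neighbourhood `(T₀, T) × B(0, r)`;
`U ∈ C²` divergence free, `P ∈ C¹`) was shown to be a LERAY PROFILE `IsLerayProfile ν a U P`, `a > 0`,
with `u(t) = lerayBackward a T U t` on a terminal interval. Here the physically decisive Liouville
theorem is transported: if the ansatz satisfies the LOCAL ENERGY ESTIMATES near the singular point,
`sup_{t₀<t<T} ∫_{B₁(0)} |u(t)|² < ∞` and `∫_{t₀}^{T} ∫_{B₁(0)} |∇u|² < ∞` — as every Leray–Hopf weak
solution does — then `U ≡ 0` (`eq_zero_of_momentum_ball_of_localEnergy`), by the tree's DISCHARGED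
`tsai_selfsimilar_local_energy_holds` (Tsai 1998 Thm 2) applied on the terminal interval where the
ansatz IS Leray's field. Reading for the census `SELFSIM-NOGO.md` / zone Z7: «no Leray–Hopf
solution is, near a singular point, an EXACT one-profile self-similar collapse in ANY clock —
parabolic, log-corrected or otherwise — unless the profile vanishes». PROVED theorems only; no
definitions, no named facts.

WHAT THIS IS NOT: not a statement about similarity-time dependent (DSS / drifting) profiles, not
Navier–Stokes evidence; «violates: none — no object».

References: T.-P. Tsai, ARMA 143 (1998), Thm 2 [Tsai1998]; J. Leray, Acta Math. 63 (1934) §20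
[Leray1934].
-/

noncomputable section

open Set Filter Topology InnerProductSpace Metric MeasureTheory
open scoped Laplacian RealInnerProductSpace ENNReal NNReal

namespace Summit.NavierStokesRegularity.FluidComputer.SelfSimilarCensus

open Literature.Analysis.FluidPDE

section LocalEnergy

variable {U : EuclideanSpace ℝ (Fin 3) → EuclideanSpace ℝ (Fin 3)} {P : EuclideanSpace ℝ (Fin 3) → ℝ}
  {lam lam' : ℝ → ℝ} {ν T₀ T r t₀ : ℝ}

/-- **No exact one-profile modulated collapse in the local energy class, for ANY clock.** `ν > 0`;
`U ∈ C²(ℝ³; ℝ³)` divergence free, `P ∈ C¹`; clock `λ > 0` differentiable on `(T₀, T)` with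
`λ(t) → +∞` as `t ↑ T`; the ansatz `u(t) = λ(t) • U(λ(t) • ·)`, `p(t) = λ(t)² P(λ(t) • ·)` solves
the Navier–Stokes momentum equation on the parabolic neighbourhood `(T₀, T) × B(0, r)` and satisfies
the local energy estimates `∫_{B₁(0)} ‖u(t)‖² ≤ C` for `t ∈ (t₀, T)` and
`∫_{t₀}^{T} ∫_{B₁(0)} |∇u(t)|²_F < ∞`. Then `U ≡ 0`. (Non-trivial branch: `u = lerayBackward a T U` on
a terminal interval `(T₁, T)` with `IsLerayProfile ν a U P`, `a > 0` —
`isLerayProfile_or_eq_zero_of_momentum_ball`; the estimates restrict to `(max t₀ T₁, T)`; Tsai 1998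
Thm 2, tree `tsai_selfsimilar_local_energy_holds`.) [folklore] -/
theorem eq_zero_of_momentum_ball_of_localEnergy (hT : T₀ < T) (hr : 0 < r)
    (hlam : ∀ t ∈ Ioo T₀ T, HasDerivAt lam (lam' t) t) (hpos : ∀ t ∈ Ioo T₀ T, 0 < lam t)
    (hblow : Tendsto lam (𝓝[<] T) atTop) (hU : ContDiff ℝ 2 U) (hP : ContDiff ℝ 1 P)
    (hdiv : VectorCalculus.IsDivFree U) (hν : 0 < ν)
    (heq : ∀ t ∈ Ioo T₀ T, ∀ x ∈ ball (0 : EuclideanSpace ℝ (Fin 3)) r,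
      timeDeriv (fun s => nsRescaleData (lam s) U) t x +
          convect (nsRescaleData (lam t) U) (nsRescaleData (lam t) U) x +
          gradient (fun y => lam t ^ 2 * P (lam t • y)) x -
          ν • (Δ (nsRescaleData (lam t) U)) x = 0)
    (ht₀ : t₀ < T)
    (henergy : ∃ C : ℝ≥0, ∀ t ∈ Ioo t₀ T,
      ∫⁻ x in ball (0 : EuclideanSpace ℝ (Fin 3)) 1, ‖nsRescaleData (lam t) U x‖ₑ ^ 2 ≤ C)
    (hgrad : ∫⁻ t in Ioo t₀ T, ∫⁻ x in ball (0 : EuclideanSpace ℝ (Fin 3)) 1,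
      ENNReal.ofReal (frobeniusNormSq (fderiv ℝ (nsRescaleData (lam t) U) x)) < ⊤) :
    U = 0 := by
  rcases isLerayProfile_or_eq_zero_of_momentum_ball hT hr hlam hpos hblow hU hP hdiv heq with
    h0 | ⟨a, T₁, ha0, -, hT₁T, hprof, hclock⟩
  · exact h0
  · -- the terminal interval `(t₁, T)`, `t₁ = max t₀ T₁`, on which `u = lerayBackward a T U`
    set t₁ := max t₀ T₁ with ht₁
    have ht₁T : t₁ < T := max_lt ht₀ hT₁T
    have hsub₀ : Ioo t₁ T ⊆ Ioo t₀ T := Ioo_subset_Ioo_left (le_max_left _ _)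
    have hsub₁ : Ioo t₁ T ⊆ Ioo T₁ T := Ioo_subset_Ioo_left (le_max_right _ _)
    have hEq : ∀ t ∈ Ioo t₁ T, nsRescaleData (lam t) U = lerayBackward a T U t :=
      fun t ht => nsRescaleData_eq_lerayBackward (hclock t (hsub₁ ht))
    refine tsai_selfsimilar_local_energy_holds hν ha0 ht₁T hprof ?_ ?_
    · obtain ⟨C, hC⟩ := henergy
      refine ⟨C, fun t ht => ?_⟩
      rw [← hEq t ht]
      exact hC t (hsub₀ ht)
    · refine lt_of_le_of_lt ?_ hgrad
      calc ∫⁻ t in Ioo t₁ T, ∫⁻ x in ball (0 : EuclideanSpace ℝ (Fin 3)) 1,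
              ENNReal.ofReal (frobeniusNormSq (fderiv ℝ (lerayBackward a T U t) x))
          = ∫⁻ t in Ioo t₁ T, ∫⁻ x in ball (0 : EuclideanSpace ℝ (Fin 3)) 1,
              ENNReal.ofReal (frobeniusNormSq (fderiv ℝ (nsRescaleData (lam t) U) x)) :=
            setLIntegral_congr_fun measurableSet_Ioo (fun t ht => by rw [hEq t ht])
        _ ≤ ∫⁻ t in Ioo t₀ T, ∫⁻ x in ball (0 : EuclideanSpace ℝ (Fin 3)) 1,
              ENNReal.ofReal (frobeniusNormSq (fderiv ℝ (nsRescaleData (lam t) U) x)) :=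
            lintegral_mono_set hsub₀

/-- **Global-slice form.** The same with the momentum equation on whole slices `(T₀, T) × ℝ³`.
[folklore] -/
theorem eq_zero_of_momentum_of_localEnergy (hT : T₀ < T)
    (hlam : ∀ t ∈ Ioo T₀ T, HasDerivAt lam (lam' t) t) (hpos : ∀ t ∈ Ioo T₀ T, 0 < lam t)
    (hblow : Tendsto lam (𝓝[<] T) atTop) (hU : ContDiff ℝ 2 U) (hP : ContDiff ℝ 1 P)
    (hdiv : VectorCalculus.IsDivFree U) (hν : 0 < ν)
    (heq : ∀ t ∈ Ioo T₀ T, ∀ x : EuclideanSpace ℝ (Fin 3),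
      timeDeriv (fun s => nsRescaleData (lam s) U) t x +
          convect (nsRescaleData (lam t) U) (nsRescaleData (lam t) U) x +
          gradient (fun y => lam t ^ 2 * P (lam t • y)) x -
          ν • (Δ (nsRescaleData (lam t) U)) x = 0)
    (ht₀ : t₀ < T)
    (henergy : ∃ C : ℝ≥0, ∀ t ∈ Ioo t₀ T,
      ∫⁻ x in ball (0 : EuclideanSpace ℝ (Fin 3)) 1, ‖nsRescaleData (lam t) U x‖ₑ ^ 2 ≤ C)
    (hgrad : ∫⁻ t in Ioo t₀ T, ∫⁻ x in ball (0 : EuclideanSpace ℝ (Fin 3)) 1,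
      ENNReal.ofReal (frobeniusNormSq (fderiv ℝ (nsRescaleData (lam t) U) x)) < ⊤) :
    U = 0 :=
  eq_zero_of_momentum_ball_of_localEnergy hT one_pos hlam hpos hblow hU hP hdiv hν
    (fun t ht x _ => heq t ht x) ht₀ henergy hgrad

end LocalEnergy

end Summit.NavierStokesRegularity.FluidComputer.SelfSimilarCensus

end
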